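import Mathlib
import HarnessLib
import Summits.NavierStokesRegularity.NavierStokesRegularity.Theorems.PoloidalWindowDoorLrcModEntireTwistingTHBranchValues

/-!
# Item `LrcModEntire` (stmt-NavierStokesRegularity-20428), skeleton twist_split v6, CLASS road to `stub_twistingTHGerm` —
# (BRANCH) road, slope dictionary from non-flatness, part 1: rates of JACOBIAN ENTRIES along vertical lines and in time

Cell ns-regularity-ideate, seat ns-k2-port-2 g4 (kernel-port lineage; `--supports stmt-NavierStokesRegularity-20428 --as helper`; toolbox for the
derivation of the slope dictionary (SD) of `…TwistingTHBranchObject` from uniform non-flatness, LEAD ns-poloidal-K2-p3 g13 memo OSC-LIOUVILLE-g13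
§5septies: «μ, μ_z, μ_zz, μ_t are plane constants equal to ratios of Jacobian entries at ANY point of the plane»).  For a class profile `v` and a
Jacobian entry `J(s,x) := (∂_u v)_i(s,x) = (Dv(s)(x)u)_i`:

* `hasDerivAt_entry_line`, `hasDerivAt_entry_line_two` — derivatives of `σ ↦ J(t, y + σw)` of first and second order (directional derivatives of
  the entry), with `entry_line_rates`: `(−t)|J| ≤ K`, `(−t)√(−t)|∂_wJ| ≤ K`, `(−t)²|∂_w∂_wJ| ≤ K` for unit `u, w` (class rates `Dv, D²v, D³v`);
* `hasDerivAt_entry_time` — **the TIME derivative of a Jacobian entry is the space derivative of the time derivative** (symmetry of the second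
  Fréchet derivative of the jointly smooth `uncurry v`): `∂ₛ J(s,y)|ₛ₌ₜ = (D(∂ₜv)(t)(y)u)_i`, with `entry_time_rate`: `(−t)²|∂ₜJ| ≤ K` (mixed class rate).

WHAT THIS IS NOT: not a claim about Navier–Stokes regularity and not the stub — calculus (bears_on LADDER-NS N0, item 20428 / crux 19708; both OPEN).
-/

noncomputable section

-- the summit and its single sub-problem share the name (CONVENTIONS §1), as in every Theorems file
set_option linter.dupNamespace false

namespace Summit.NavierStokesRegularity.NavierStokesRegularity.Theorems.PoloidalWindowDoorLrcModEntireTwistingTHJacobianRates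

open Set Function Filter Topology
open scoped RealInnerProductSpace InnerProductSpace
open Literature.Analysis Literature.Analysis.FluidPDE
open Summit.NavierStokesRegularity.NavierStokesRegularity.Theorems.PoloidalWindowDoorPoloidalWindowRigidityWindow
open Summit.NavierStokesRegularity.NavierStokesRegularity.Theorems.PoloidalWindowDoorPoloidalWindowRigidityClassSpaceTimeRates
open Summit.NavierStokesRegularity.NavierStokesRegularity.Theorems.PoloidalWindowDoorLrcModEntireTwistingTHBranchValues

/-! ### Generic helpers -/

/-- Coordinate `i` of a derivative is the derivative of coordinate `i` (curves in `ℝ³`). -/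
theorem hasDerivAt_apply_coord {γ : ℝ → EuclideanSpace ℝ (Fin 3)} {γ' : EuclideanSpace ℝ (Fin 3)} {s : ℝ} (i : Fin 3)
    (h : HasDerivAt γ γ' s) : HasDerivAt (fun s => γ s i) (γ' i) s :=
  (EuclideanSpace.proj (𝕜 := ℝ) i).hasFDerivAt.comp_hasDerivAt s h

/-- A differentiable vector field along a line: `σ ↦ G(y + σw)` has derivative `DG(y + σw)w`. -/
theorem hasDerivAt_comp_line_vec {G : EuclideanSpace ℝ (Fin 3) → EuclideanSpace ℝ (Fin 3)} (hG : Differentiable ℝ G)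
    (y w : EuclideanSpace ℝ (Fin 3)) (σ : ℝ) : HasDerivAt (fun σ : ℝ => G (y + σ • w)) (fderiv ℝ G (y + σ • w) w) σ := by
  have hl : HasDerivAt (fun σ : ℝ => y + σ • w) w σ := by
    simpa using ((hasDerivAt_id σ).smul_const w).const_add y
  exact (hG (y + σ • w)).hasFDerivAt.comp_hasDerivAt σ hl

/-- A coordinate of a vector is bounded by its norm. -/
theorem abs_coord_le_norm (x : EuclideanSpace ℝ (Fin 3)) (i : Fin 3) : |x i| ≤ ‖x‖ := by
  rw [← Real.norm_eq_abs]; exact PiLp.norm_apply_le x i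

/-! ### The class setting -/

section Class

variable {C : ℝ} {v : ℝ → EuclideanSpace ℝ (Fin 3) → EuclideanSpace ℝ (Fin 3)}
variable (hrate : HasTypeITimeDecay C v) (hcont : ContinuousOn (uncurry v) (Iio (0 : ℝ) ×ˢ univ))
  (hmild : ∀ s t : ℝ, s < t → t < 0 → ∀ x,
    v t x = UnboundedOperators.heatExtension (v s) (t - s) x - oseenDuhamel 1 s v v t x)
  (hdiv : ∀ t < 0, VectorCalculus.IsDivFree (v t))

include hrate hcont hmild hdiv

/-- Slices are `C^∞`; in particular `C³`. -/
theorem contDiff_three_slice {t : ℝ} (ht : t < 0) : ContDiff ℝ 3 (v t) :=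
  ((isTypeIAncientMild_of_class hrate hcont hmild hdiv).contDiff_slice ht).of_le (by norm_cast)

/-- The entry map `x ↦ Dv(t)(x)u` is `C²` and `x ↦ D(x ↦ Dv(t)(x)u)(x)w` is `C¹`. -/
theorem contDiff_entry {t : ℝ} (ht : t < 0) (u w : EuclideanSpace ℝ (Fin 3)) :
    ContDiff ℝ 2 (fun x => fderiv ℝ (v t) x u) ∧ ContDiff ℝ 1 (fun x => fderiv ℝ (fun x => fderiv ℝ (v t) x u) x w) := by
  have h3 := contDiff_three_slice hrate hcont hmild hdiv ht
  have h2 : ContDiff ℝ 2 (fun x => fderiv ℝ (v t) x u) := (h3.fderiv_right (m := 2) (by norm_cast)).clm_apply contDiff_const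
  exact ⟨h2, (h2.fderiv_right (m := 1) (by norm_cast)).clm_apply contDiff_const⟩

/-- **First line derivative of a Jacobian entry**: `σ ↦ (Dv(t)(y+σw)u)_i` has derivative `(D(x ↦ Dv(t)(x)u)(y+σw)w)_i`. -/
theorem hasDerivAt_entry_line {t : ℝ} (ht : t < 0) (y w u : EuclideanSpace ℝ (Fin 3)) (i : Fin 3) (σ : ℝ) :
    HasDerivAt (fun σ : ℝ => (fderiv ℝ (v t) (y + σ • w) u) i)
      ((fderiv ℝ (fun x => fderiv ℝ (v t) x u) (y + σ • w) w) i) σ :=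
  hasDerivAt_apply_coord i (hasDerivAt_comp_line_vec ((contDiff_entry hrate hcont hmild hdiv ht u w).1.differentiable (by norm_num)) y w σ)

/-- **Second line derivative of a Jacobian entry.** -/
theorem hasDerivAt_entry_line_two {t : ℝ} (ht : t < 0) (y w u : EuclideanSpace ℝ (Fin 3)) (i : Fin 3) (σ : ℝ) :
    HasDerivAt (fun σ : ℝ => (fderiv ℝ (fun x => fderiv ℝ (v t) x u) (y + σ • w) w) i)
      ((fderiv ℝ (fun x => fderiv ℝ (fun x => fderiv ℝ (v t) x u) x w) (y + σ • w) w) i) σ :=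
  hasDerivAt_apply_coord i (hasDerivAt_comp_line_vec ((contDiff_entry hrate hcont hmild hdiv ht u w).2.differentiable (by norm_num)) y w σ)

/-- **Rates of a Jacobian entry and of its first two line derivatives** (unit directions): one `K ≥ 0` per profile with
`(−t)|(Dv u)_i| ≤ K`, `(−t)√(−t)|(D(Dv u)w)_i| ≤ K`, `(−t)²|(D(D(Dv u)w)w)_i| ≤ K`. -/
theorem entry_line_rates : ∃ K : ℝ, 0 ≤ K ∧ ∀ t < 0, ∀ x w u : EuclideanSpace ℝ (Fin 3), ‖w‖ ≤ 1 → ‖u‖ ≤ 1 → ∀ i : Fin 3,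
    (-t) * |(fderiv ℝ (v t) x u) i| ≤ K ∧
    (-t) * Real.sqrt (-t) * |(fderiv ℝ (fun x => fderiv ℝ (v t) x u) x w) i| ≤ K ∧
    (-t) ^ 2 * |(fderiv ℝ (fun x => fderiv ℝ (fun x => fderiv ℝ (v t) x u) x w) x w) i| ≤ K := by
  obtain ⟨K1, hK10, hK1⟩ := exists_fderiv_rate_of_class' hrate hcont hmild
  obtain ⟨K2, hK20, hK2⟩ := exists_iteratedFDeriv_two_rate_of_class' hrate hcont hmild
  obtain ⟨K3, hK30, hK3⟩ := exists_iteratedFDeriv_three_rate_of_class hrate hcont hmild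
  refine ⟨K1 + K2 + K3, by positivity, fun t ht x w u hw hu i => ⟨?_, ?_, ?_⟩⟩
  all_goals have hnt : 0 < -t := neg_pos.2 ht
  all_goals have hs : 0 < Real.sqrt (-t) := Real.sqrt_pos.2 hnt
  all_goals have h3 := contDiff_three_slice hrate hcont hmild hdiv ht
  · -- `|(Dv u)_i| ≤ ‖Dv‖‖u‖ ≤ K1/(−t)`
    have h1 : |(fderiv ℝ (v t) x u) i| ≤ ‖fderiv ℝ (v t) x‖ :=
      (abs_coord_le_norm _ i).trans ((ContinuousLinearMap.le_opNorm _ _).trans (by nlinarith [norm_nonneg (fderiv ℝ (v t) x), hu]))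
    have h2 := hK1 t ht x
    have ht0 : t ≠ 0 := ht.ne
    calc (-t) * |(fderiv ℝ (v t) x u) i| ≤ (-t) * (K1 / (-t)) := mul_le_mul_of_nonneg_left (h1.trans h2) hnt.le
      _ = K1 := by field_simp
      _ ≤ K1 + K2 + K3 := by linarith
  · -- `|(D(Dv u)w)_i| = |(D²v[w,u])_i| ≤ ‖D²v‖ ≤ K2/((−t)√(−t))`
    have h2v : ContDiff ℝ 2 (v t) := h3.of_le (by norm_cast)
    rw [fderiv_fderiv_apply_eq_iteratedFDeriv_two h2v]
    have h1 : |(iteratedFDeriv ℝ 2 (v t) x ![w, u]) i| ≤ ‖iteratedFDeriv ℝ 2 (v t) x‖ := by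
      refine (abs_coord_le_norm _ i).trans ((ContinuousMultilinearMap.le_opNorm _ _).trans ?_)
      rw [Fin.prod_univ_two]
      have e0 : (![w, u] : Fin 2 → EuclideanSpace ℝ (Fin 3)) 0 = w := rfl
      have e1 : (![w, u] : Fin 2 → EuclideanSpace ℝ (Fin 3)) 1 = u := rfl
      rw [e0, e1]
      have := norm_nonneg (iteratedFDeriv ℝ 2 (v t) x)
      calc ‖iteratedFDeriv ℝ 2 (v t) x‖ * (‖w‖ * ‖u‖) ≤ ‖iteratedFDeriv ℝ 2 (v t) x‖ * (1 * 1) :=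
            mul_le_mul_of_nonneg_left (mul_le_mul hw hu (norm_nonneg _) zero_le_one) this
        _ = ‖iteratedFDeriv ℝ 2 (v t) x‖ := by ring
    have h2 := hK2 t ht x
    have ht0 : t ≠ 0 := ht.ne
    have hs0 : Real.sqrt (-t) ≠ 0 := hs.ne'
    calc (-t) * Real.sqrt (-t) * |(iteratedFDeriv ℝ 2 (v t) x ![w, u]) i| ≤ (-t) * Real.sqrt (-t) * (K2 / ((-t) * Real.sqrt (-t))) :=
          mul_le_mul_of_nonneg_left (h1.trans h2) (mul_pos hnt hs).le
      _ = K2 := by field_simp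
      _ ≤ K1 + K2 + K3 := by linarith
  · -- `|(D(D(Dv u)w)w)_i| ≤ ‖D²(x ↦ Dv u)(x)‖‖w‖² ≤ ‖u‖‖D³v‖ ≤ K3/(−t)²`
    obtain ⟨hg2, -⟩ := contDiff_entry hrate hcont hmild hdiv ht u w
    rw [fderiv_fderiv_apply_eq_iteratedFDeriv_two hg2]
    have hA : ‖iteratedFDeriv ℝ 2 (fun x => fderiv ℝ (v t) x u) x‖ ≤ ‖u‖ * ‖iteratedFDeriv ℝ 3 (v t) x‖ := by
      have h := norm_iteratedFDeriv_clm_apply_const (f := fderiv ℝ (v t)) (c := u) (x := x) (n := 2)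
        ((h3.fderiv_right (m := 2) (by norm_cast)).contDiffAt) le_rfl
      rw [norm_iteratedFDeriv_fderiv] at h
      exact h
    have h1 : |(iteratedFDeriv ℝ 2 (fun x => fderiv ℝ (v t) x u) x ![w, w]) i| ≤ ‖iteratedFDeriv ℝ 3 (v t) x‖ := by
      refine (abs_coord_le_norm _ i).trans ((ContinuousMultilinearMap.le_opNorm _ _).trans ?_)
      rw [Fin.prod_univ_two]
      have e0 : (![w, w] : Fin 2 → EuclideanSpace ℝ (Fin 3)) 0 = w := rfl
      have e1 : (![w, w] : Fin 2 → EuclideanSpace ℝ (Fin 3)) 1 = w := rfl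
      rw [e0, e1]
      have hn3 := norm_nonneg (iteratedFDeriv ℝ 3 (v t) x)
      have hn2 := norm_nonneg (iteratedFDeriv ℝ 2 (fun x => fderiv ℝ (v t) x u) x)
      calc ‖iteratedFDeriv ℝ 2 (fun x => fderiv ℝ (v t) x u) x‖ * (‖w‖ * ‖w‖)
          ≤ (‖u‖ * ‖iteratedFDeriv ℝ 3 (v t) x‖) * (1 * 1) := mul_le_mul hA (mul_le_mul hw hw (norm_nonneg _) zero_le_one) (by positivity) (by positivity)
        _ ≤ (1 * ‖iteratedFDeriv ℝ 3 (v t) x‖) * (1 * 1) := by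
            have := mul_le_mul_of_nonneg_right hu hn3
            nlinarith
        _ = ‖iteratedFDeriv ℝ 3 (v t) x‖ := by ring
    have h2 := hK3 t ht x
    have ht0 : t ≠ 0 := ht.ne
    calc (-t) ^ 2 * |(iteratedFDeriv ℝ 2 (fun x => fderiv ℝ (v t) x u) x ![w, w]) i| ≤ (-t) ^ 2 * (K3 / (-t) ^ 2) :=
          mul_le_mul_of_nonneg_left (h1.trans h2) (pow_pos hnt 2).le
      _ = K3 := by field_simp
      _ ≤ K1 + K2 + K3 := by linarith

/-- **THE TIME DERIVATIVE OF A JACOBIAN ENTRY** is the space derivative (in the same direction) of the time derivative of the field, by the symmetry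
of the second Fréchet derivative of the jointly smooth `uncurry v`:  `∂ₛ (Dv(s)(y)u)_i |ₛ₌ₜ = (D(x ↦ ∂ₜv(t,x))(y)u)_i`. -/
theorem hasDerivAt_entry_time {t : ℝ} (ht : t < 0) (y u : EuclideanSpace ℝ (Fin 3)) (i : Fin 3) :
    HasDerivAt (fun s => (fderiv ℝ (v s) y u) i) ((fderiv ℝ (fun x => deriv (fun τ => v τ x) t) y u) i) t := by
  set Φ : ℝ × EuclideanSpace ℝ (Fin 3) → EuclideanSpace ℝ (Fin 3) := uncurry v with hΦ
  have hA := (isTypeIAncientMild_of_class hrate hcont hmild hdiv).contDiffOn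
  have hslab : IsOpen (Iio (0 : ℝ) ×ˢ (univ : Set (EuclideanSpace ℝ (Fin 3)))) := isOpen_Iio.prod isOpen_univ
  have hmem : ∀ {s : ℝ} (x : EuclideanSpace ℝ (Fin 3)), s < 0 → Iio (0 : ℝ) ×ˢ (univ : Set (EuclideanSpace ℝ (Fin 3))) ∈ 𝓝 (s, x) :=
    fun x hs => hslab.mem_nhds (mk_mem_prod hs (mem_univ x))
  have hΦ2 : ContDiffAt ℝ 2 Φ (t, y) := (hA.of_le (by norm_cast)).contDiffAt (hmem y ht)
  -- `Φ` is differentiable near `(t,y)` and `DΦ` is differentiable at `(t,y)`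
  have hΦd : ∀ {s : ℝ} (x : EuclideanSpace ℝ (Fin 3)), s < 0 → HasFDerivAt Φ (fderiv ℝ Φ (s, x)) (s, x) := fun x hs =>
    (((hA.of_le (by norm_cast : (1 : WithTop ℕ∞) ≤ _)).differentiableOn (by norm_num)).differentiableAt (hmem x hs)).hasFDerivAt
  have hDΦd : DifferentiableAt ℝ (fderiv ℝ Φ) (t, y) := by
    have h := hΦ2.fderiv_right (m := 1) (by norm_cast)
    exact h.differentiableAt (by norm_num)
  have hsymm : IsSymmSndFDerivAt ℝ Φ (t, y) := hΦ2.isSymmSndFDerivAt (by simp)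
  -- space slices: `Dv(s)(x) = DΦ(s,x) ∘ inr`
  have hspace : ∀ {s : ℝ} (x : EuclideanSpace ℝ (Fin 3)), s < 0 →
      fderiv ℝ (v s) x u = fderiv ℝ Φ (s, x) (0, u) := by
    intro s x hs
    have h := ((hΦd x hs).comp x (hasFDerivAt_prodMk_right s x)).fderiv
    have e : (Φ ∘ Prod.mk s) = v s := rfl
    rw [e] at h
    rw [h]; simp
  -- time slices: `∂ₜv(t,x) = DΦ(t,x)(1,0)`
  have htime : ∀ x : EuclideanSpace ℝ (Fin 3), deriv (fun τ => v τ x) t = fderiv ℝ Φ (t, x) (1, 0) := by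
    intro x
    have h := ((hΦd x ht).comp t (hasFDerivAt_prodMk_left t x)).hasDerivAt
    have e : (Φ ∘ fun τ : ℝ => (τ, x)) = fun τ => v τ x := rfl
    rw [e] at h
    rw [h.deriv]; simp
  -- (a) `s ↦ DΦ(s,y)(0,u)` has derivative `D²Φ(t,y)[(1,0)](0,u)` at `t`
  have ha : HasDerivAt (fun s => fderiv ℝ Φ (s, y) (0, u)) ((fderiv ℝ (fderiv ℝ Φ) (t, y) (1, 0)) (0, u)) t := by
    have h1 := (hDΦd.hasFDerivAt.comp t (hasFDerivAt_prodMk_left t y)).hasDerivAt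
    have h2 := h1.clm_apply (hasDerivAt_const t ((0, u) : ℝ × EuclideanSpace ℝ (Fin 3)))
    simpa using h2
  -- (b) `σ ↦ DΦ(t, y+σu)(1,0)` i.e. `x ↦ ∂ₜv(t,x)` has directional derivative `D²Φ(t,y)[(0,u)](1,0)` in the direction `u`
  have hb : HasFDerivAt (fun x => fderiv ℝ Φ (t, x) (1, 0))
      (((fderiv ℝ (fderiv ℝ Φ) (t, y)).comp (ContinuousLinearMap.inr ℝ ℝ (EuclideanSpace ℝ (Fin 3)))).flip (1, 0)) y := by
    have h1 := hDΦd.hasFDerivAt.comp y (hasFDerivAt_prodMk_right t y)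
    exact h1.clm_apply (hasFDerivAt_const ((1, 0) : ℝ × EuclideanSpace ℝ (Fin 3)) y)
      |>.congr_fderiv (by ext w; simp)
  have hb' : fderiv ℝ (fun x => deriv (fun τ => v τ x) t) y u = (fderiv ℝ (fderiv ℝ Φ) (t, y) (0, u)) (1, 0) := by
    have e : (fun x => deriv (fun τ => v τ x) t) = fun x => fderiv ℝ Φ (t, x) (1, 0) := funext htime
    rw [e, hb.fderiv]; simp
  -- symmetry and assembly
  have hsym : (fderiv ℝ (fderiv ℝ Φ) (t, y) (1, 0)) (0, u) = (fderiv ℝ (fderiv ℝ Φ) (t, y) (0, u)) (1, 0) := hsymm _ _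
  have hev : (fun s => (fderiv ℝ (v s) y u) i) =ᶠ[𝓝 t] fun s => (fderiv ℝ Φ (s, y) (0, u)) i := by
    filter_upwards [Iio_mem_nhds ht] with s hs
    rw [hspace y hs]
  have hfin : HasDerivAt (fun s => (fderiv ℝ Φ (s, y) (0, u)) i) (((fderiv ℝ (fderiv ℝ Φ) (t, y) (1, 0)) (0, u)) i) t :=
    hasDerivAt_apply_coord i ha
  rw [hsym, ← hb'] at hfin
  exact hfin.congr_of_eventuallyEq hev

omit hdiv in
/-- **Mixed rate**: `(−t)²·|∂ₜ(Dv u)_i| ≤ K` for unit `u` (from `exists_fderiv_deriv_rate_of_class`). -/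
theorem entry_time_rate : ∃ K : ℝ, 0 ≤ K ∧ ∀ t < 0, ∀ y u : EuclideanSpace ℝ (Fin 3), ‖u‖ ≤ 1 → ∀ i : Fin 3,
    (-t) ^ 2 * |(fderiv ℝ (fun x => deriv (fun τ => v τ x) t) y u) i| ≤ K := by
  obtain ⟨K, hK0, hK⟩ := exists_fderiv_deriv_rate_of_class hrate hcont hmild
  refine ⟨K, hK0, fun t ht y u hu i => ?_⟩
  have hnt : 0 < -t := neg_pos.2 ht
  have h1 : |(fderiv ℝ (fun x => deriv (fun τ => v τ x) t) y u) i| ≤ ‖fderiv ℝ (fun x => deriv (fun τ => v τ x) t) y‖ :=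
    (abs_coord_le_norm _ i).trans ((ContinuousLinearMap.le_opNorm _ _).trans
      (by nlinarith [norm_nonneg (fderiv ℝ (fun x => deriv (fun τ => v τ x) t) y), hu]))
  have h2 := hK t ht y
  have ht0 : t ≠ 0 := ht.ne
  calc (-t) ^ 2 * |(fderiv ℝ (fun x => deriv (fun τ => v τ x) t) y u) i| ≤ (-t) ^ 2 * (K / (-t) ^ 2) :=
        mul_le_mul_of_nonneg_left (h1.trans h2) (pow_pos hnt 2).le
    _ = K := by field_simp

end Class

end Summit.NavierStokesRegularity.NavierStokesRegularity.Theorems.PoloidalWindowDoorLrcModEntireTwistingTHJacobianRates
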